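import Mathlib
import HarnessLib
import Literature.Computability.AlgebraicComplexity.SymmetricArithCircuit
import Literature.Computability.AlgebraicComplexity.DawarWilsenach2025Proofs
import Literature.Computability.AlgebraicComplexity.MonotoneStructure
import Summits.ValiantsHypothesis.ValiantsHypothesis.Theorems.MonotoneRestorationMonotoneRestorationQPGateSupport
import Summits.ValiantsHypothesis.ValiantsHypothesis.Theorems.MonotoneRestorationMonotoneRestorationQPAltOrbitDichotomy
import Summits.ValiantsHypothesis.ValiantsHypothesis.Theorems.MonotoneRestorationMonotoneRestorationQPMulGateChildren

/-!
# ValiantsHypothesis / MonotoneRestoration — `MonotoneRestorationQP`, line `Sketch`, stub G6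

Support file for crux item `stmt-ValiantsHypothesis-15886`
(`Summit.ValiantsHypothesis.ValiantsHypothesis.Theses.MonotoneRestoration.MonotoneRestorationQP`),
line `Sketch`, stub `stub_symmetricMonotone_choose_le_card` (THEOREM γ: a `Sym_n`-symmetric
MONOTONE circuit computing a nonzero homogeneous row-multilinear polynomial of degree
`d ≥ k²` (`d + k + 9 ≤ n`, `4k ≤ n`) has at least `C(n, k)` gates).

Proof (well-founded descent).  If `|G| < C(n,k)`, every gate `g` has a set `X_g` of `< k` rows
with `Alt([n] ∖ X_g)` extending to automorphisms fixing `g` (G1 `stub_gateSupport`), so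
`eval g` is invariant under the corresponding diagonal renamings.  Call `g` *used* if its
monomials extend uniformly into `supp f` (`∃ μ, ∀ m ∈ supp (eval g), m + μ ∈ supp f`) and *big*
if a monomial of `eval g` touches a row outside `X_g`.  For a used big `g`: the rows of `μ` lie
in `X_g` (move the touched row by a `3`-cycle; row-multilinearity of `m + μ`), so every monomial
of `eval g` has `≥ d - k + 1 ≥ k` rows and escapes every `X_h`; `g` is then not an input, a `+`
gate has a used big child (the one carrying the big monomial, no cancellation over `ℝ≥0`), and
a `×` gate too: the child `h₁` carrying the outside row is, by G3 `stub_mulGate_children_extend`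
and G2 `stub_altFixing_orbit_dichotomy` (its orbit stays among the `≤ d` non-constant children),
used and `Alt([n] ∖ X_g)`-invariant, hence touches every row outside `X_g`, one of them outside
`X_{h₁}`.  By induction along the wires no gate is used and big — but the output is.
-/

-- `Summit.ValiantsHypothesis.ValiantsHypothesis.…` is the tree's mandated single-conjunct layout
-- (Sub = Summit), so the duplicated namespace component is intended.
set_option linter.dupNamespace false

noncomputable section

namespace Summit.ValiantsHypothesis.ValiantsHypothesis.Theorems

open Literature.Computability.AlgebraicComplexity MvPolynomial
open scoped NNReal

/-- The diagonal renaming along a permutation is injective. [folklore] -/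
theorem gamma_diag_injective {n : ℕ} (ρ : Equiv.Perm (Fin n)) :
    Function.Injective (fun p : Fin n × Fin n => (ρ p.1, ρ p.2)) := by
  intro p q h
  simp only [Prod.mk.injEq, EmbeddingLike.apply_eq_iff_eq] at h
  exact Prod.ext h.1 h.2

/-- Row degrees of a diagonally renamed monomial are the renamed row degrees. [folklore] -/
theorem gamma_rowDegrees_mapDomain {n : ℕ} (ρ : Equiv.Perm (Fin n)) (m : Fin n × Fin n →₀ ℕ) :
    rowDegrees (Finsupp.mapDomain (fun p : Fin n × Fin n => (ρ p.1, ρ p.2)) m) =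
      Finsupp.mapDomain ρ (rowDegrees m) := by
  simp only [rowDegrees, ← Finsupp.mapDomain_comp]
  rfl

/-- A row-multilinear monomial has as many rows as its degree. [folklore] -/
theorem gamma_degree_eq_card_rows {n : ℕ} {m : Fin n × Fin n →₀ ℕ}
    (h : ∀ i, rowDegrees m i ≤ 1) : m.degree = (rowDegrees m).support.card := by
  rw [← degree_rowDegrees, Finsupp.degree_apply, Finset.card_eq_sum_ones]
  refine Finset.sum_congr rfl fun i hi => ?_
  have h1 := h i
  have h2 := Finsupp.mem_support_iff.1 hi
  omega

/-- Over `ℝ≥0`, a monomial of a finite product of polynomials is a sum of monomials of the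
factors (`support_mul`). [folklore] -/
theorem gamma_mem_support_prod {n : ℕ} {G : Type*} [DecidableEq G] (s : Finset G)
    (p : G → MvPolynomial (Fin n × Fin n) ℝ≥0) {m : Fin n × Fin n →₀ ℕ}
    (hm : m ∈ (∏ h ∈ s, p h).support) :
    ∃ ν : G → (Fin n × Fin n →₀ ℕ), (∀ h ∈ s, ν h ∈ (p h).support) ∧ m = ∑ h ∈ s, ν h := by
  classical
  induction s using Finset.induction_on generalizing m with
  | empty =>
    refine ⟨fun _ => 0, fun h hh => absurd hh (Finset.notMem_empty h), ?_⟩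
    rw [Finset.prod_empty] at hm
    have : m = 0 := by
      by_contra hne
      rw [mem_support_iff, ← C_1, coeff_C, if_neg (Ne.symm hne)] at hm
      exact hm rfl
    rw [this, Finset.sum_empty]
  | insert a s ha ih =>
    rw [Finset.prod_insert ha] at hm
    obtain ⟨ma, hma, m', hm', rfl⟩ := Finset.mem_add.1 (support_mul _ _ hm)
    obtain ⟨ν, hν, rfl⟩ := ih hm'
    refine ⟨Function.update ν a ma, fun h hh => ?_, ?_⟩
    · rcases Finset.mem_insert.1 hh with rfl | hh
      · rw [Function.update_self]; exact hma
      · rw [Function.update_of_ne (ne_of_mem_of_not_mem hh ha)]; exact hν h hh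
    · rw [Finset.sum_insert ha, Function.update_self]
      congr 1
      exact Finset.sum_congr rfl fun h hh =>
        (Function.update_of_ne (ne_of_mem_of_not_mem hh ha) _ _).symm

/-- Over `ℝ≥0`, a sum of monomials of the factors is a monomial of the product (no
cancellation, `add_mem_support_mul`). [folklore] -/
theorem gamma_sum_mem_support_prod {n : ℕ} {G : Type*} [DecidableEq G] (s : Finset G)
    (p : G → MvPolynomial (Fin n × Fin n) ℝ≥0) {ν : G → (Fin n × Fin n →₀ ℕ)}
    (hν : ∀ h ∈ s, ν h ∈ (p h).support) : ∑ h ∈ s, ν h ∈ (∏ h ∈ s, p h).support := by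
  classical
  induction s using Finset.induction_on with
  | empty =>
    rw [Finset.sum_empty, Finset.prod_empty, mem_support_iff, ← C_1, coeff_C, if_pos rfl]
    exact one_ne_zero
  | insert a s ha ih =>
    rw [Finset.sum_insert ha, Finset.prod_insert ha]
    exact add_mem_support_mul (hν a (Finset.mem_insert_self a s))
      (ih fun h hh => hν h (Finset.mem_insert_of_mem hh))

/-- `Alt([n] ∖ X)` is transitive on `[n] ∖ X` (`|X| + 3 ≤ n`): a `3`-cycle (or the identity)
fixing `X` pointwise carries `a ∉ X` to `b ∉ X`. [folklore] -/
theorem gamma_exists_threeCycle {n : ℕ} {X : Finset (Fin n)} (hX : X.card + 3 ≤ n)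
    {a b : Fin n} (ha : a ∉ X) (hb : b ∉ X) :
    ∃ ρ : Equiv.Perm (Fin n), (∀ x ∈ X, ρ x = x) ∧ Equiv.Perm.sign ρ = 1 ∧ ρ a = b := by
  classical
  by_cases hab : a = b
  · exact ⟨1, fun x _ => rfl, Equiv.Perm.sign_one, by rw [Equiv.Perm.one_apply, hab]⟩
  -- a third point outside `X ∪ {a, b}`
  obtain ⟨c, hc⟩ : ∃ c, c ∉ insert a (insert b X) := by
    by_contra hcon
    push Not at hcon
    have h1 : (insert a (insert b X)).card ≤ X.card + 2 :=
      (Finset.card_insert_le _ _).trans (by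
        have := Finset.card_insert_le b X; omega)
    have h2 : Finset.univ ⊆ insert a (insert b X) := fun x _ => hcon x
    have h3 := Finset.card_le_card h2
    rw [Finset.card_univ, Fintype.card_fin] at h3
    omega
  simp only [Finset.mem_insert, not_or] at hc
  obtain ⟨hca, hcb, hcX⟩ := hc
  refine ⟨Equiv.swap a b * Equiv.swap b c, fun x hx => ?_, ?_, ?_⟩
  · have hxa : x ≠ a := fun h => ha (h ▸ hx)
    have hxb : x ≠ b := fun h => hb (h ▸ hx)
    have hxc : x ≠ c := fun h => hcX (h ▸ hx)
    rw [Equiv.Perm.mul_apply, Equiv.swap_apply_of_ne_of_ne hxb hxc,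
      Equiv.swap_apply_of_ne_of_ne hxa hxb]
  · rw [map_mul, Equiv.Perm.sign_swap hab, Equiv.Perm.sign_swap (Ne.symm hcb)]
    rfl
  · rw [Equiv.Perm.mul_apply, Equiv.swap_apply_of_ne_of_ne hab (Ne.symm hca),
      Equiv.swap_apply_left]

/-- A gate fixed by an automorphism extending `ρ` computes a polynomial invariant under the
diagonal renaming along `ρ` (`IsAutomorphismExtending.eval_apply`). [cite: DawarWilsenach2025, §3.2 (after Def. 3.7)] -/
theorem gamma_rename_eval_eq {n : ℕ} {G : Type*}
    {C : LabelledArithCircuit ℝ≥0 (Fin n × Fin n) Unit G} {ρ : Equiv.Perm (Fin n)}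
    {π : Equiv.Perm G} (hπ : C.IsAutomorphismExtending ρ π) {g : G} (hg : π g = g) :
    MvPolynomial.rename (fun p : Fin n × Fin n => (ρ p.1, ρ p.2)) (C.eval g) = C.eval g := by
  have h := hπ.eval_apply g
  rw [hg] at h
  exact h.symm

/-- **G6 — THEOREM γ (symmetric monotone circuits for row-multilinear invariants are large).**
A `Sym_n`-symmetric labelled arithmetic circuit over `ℝ≥0` on the matrix of variables `x_ij`
(diagonal action) whose output is a nonzero homogeneous row-multilinear polynomial of degree
`d` with `k² ≤ d`, `d + k + 9 ≤ n`, `2 ≤ k`, `4k ≤ n`, `n > 8`, has at least `C(n, k)` gates.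
Proof by well-founded descent: with fewer gates every gate has a support of fewer than `k` rows
(G1), and a gate whose monomials extend uniformly into the output ("used") and touch a row
outside its support ("big") always has a used big child (G2 at `×` gates, no cancellation at
`+` gates), while the output itself is used and big. [new result of this line; uses
`stub_gateSupport`, `stub_altFixing_orbit_dichotomy`, `stub_mulGate_children_extend`] -/
theorem stub_symmetricMonotone_choose_le_card {n : ℕ} {G : Type} [Fintype G]
    (C : LabelledArithCircuit NNReal (Fin n × Fin n) Unit G)
    (hC : C.IsSymmetric (Equiv.Perm (Fin n))) {d k : ℕ}
    (hhom : (C.eval (C.output ())).IsHomogeneous d) (h0 : C.eval (C.output ()) ≠ 0)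
    (hrow : ∀ m ∈ (C.eval (C.output ())).support, ∀ i : Fin n, rowDegrees m i ≤ 1)
    (hn : 8 < n) (hk : 2 ≤ k) (h4k : 4 * k ≤ n) (hkd : k * k ≤ d) (hdk : d + k + 9 ≤ n) :
    n.choose k ≤ Fintype.card G := by
  classical
  by_contra hlt
  push Not at hlt
  -- arithmetic: `k ≤ d - (k - 1)`
  have hkk : 2 * k ≤ k * k := Nat.mul_le_mul_right k hk
  generalize hK : k * k = K at hkd hkk
  set f := C.eval (C.output ()) with hf
  -- G1: supports of the gates
  have hG1 := fun g : G => stub_gateSupport C hC hn (show 1 ≤ k by omega) h4k hlt g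
  choose Xs hXcard hXfix using hG1
  -- invariance of the computed polynomials
  have hinv : ∀ (g : G) (ρ : Equiv.Perm (Fin n)), (∀ x ∈ Xs g, ρ x = x) →
      Equiv.Perm.sign ρ = 1 →
      MvPolynomial.rename (fun p : Fin n × Fin n => (ρ p.1, ρ p.2)) (C.eval g) = C.eval g := by
    intro g ρ hρ hs
    obtain ⟨π, hπ, hπg⟩ := hXfix g ρ hρ hs
    exact gamma_rename_eval_eq hπ hπg
  -- monomials of `f` have degree `d`
  have hdegf : ∀ M ∈ f.support, M.degree = d := by
    intro M hM
    rw [Finsupp.degree_apply]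
    exact (hhom.degree_eq_sum_deg_support hM).symm
  -- MAIN CLAIM: no gate is used and big
  have key : ∀ g : G,
      (∃ μ : Fin n × Fin n →₀ ℕ, ∀ m ∈ (C.eval g).support, m + μ ∈ f.support) →
      (∃ m ∈ (C.eval g).support, ∃ i ∉ Xs g, rowDegrees m i ≠ 0) → False := by
    intro g
    induction g using C.wf.induction with
    | h g ih =>
      rintro ⟨μ, hμ⟩ ⟨m₁, hm₁, i₁, hi₁, hmi₁⟩
      have hΩ3 : (Xs g).card + 3 ≤ n := by have := hXcard g; omega
      -- renamed monomials stay in the support of an invariant polynomial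
      have hren : ∀ (q : MvPolynomial (Fin n × Fin n) ℝ≥0) (ρ : Equiv.Perm (Fin n))
          (m : Fin n × Fin n →₀ ℕ),
          MvPolynomial.rename (fun p : Fin n × Fin n => (ρ p.1, ρ p.2)) q = q →
          m ∈ q.support →
          Finsupp.mapDomain (fun p : Fin n × Fin n => (ρ p.1, ρ p.2)) m ∈ q.support := by
        intro q ρ m hq hm
        rw [← hq, mem_support_iff, coeff_rename_mapDomain _ (gamma_diag_injective ρ)]
        exact mem_support_iff.1 hm
      have hrenrow : ∀ (ρ : Equiv.Perm (Fin n)) (m : Fin n × Fin n →₀ ℕ) (i : Fin n),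
          rowDegrees (Finsupp.mapDomain (fun p : Fin n × Fin n => (ρ p.1, ρ p.2)) m) (ρ i) =
            rowDegrees m i := by
        intro ρ m i
        rw [gamma_rowDegrees_mapDomain, Finsupp.mapDomain_apply ρ.injective]
      -- Step A: the rows of the context `μ` lie in `X_g`
      have hrowsμ : ∀ i, rowDegrees μ i ≠ 0 → i ∈ Xs g := by
        intro i hi
        by_contra hiX
        obtain ⟨ρ, hρX, hρs, hρa⟩ := gamma_exists_threeCycle hΩ3 hi₁ hiX
        have hm_supp := hren _ ρ m₁ (hinv g ρ hρX hρs) hm₁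
        have hmi : rowDegrees
            (Finsupp.mapDomain (fun p : Fin n × Fin n => (ρ p.1, ρ p.2)) m₁) i ≠ 0 := by
          rw [← hρa, hrenrow]; exact hmi₁
        have h1 := hrow _ (hμ _ hm_supp) i
        rw [rowDegrees_add, Finsupp.add_apply] at h1
        omega
      have hμrow : ∀ i, rowDegrees μ i ≤ 1 := by
        intro i
        have h1 := hrow (m₁ + μ) (hμ m₁ hm₁) i
        rw [rowDegrees_add, Finsupp.add_apply] at h1
        omega
      have hμdeg : μ.degree ≤ k - 1 := by
        rw [gamma_degree_eq_card_rows hμrow]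
        calc (rowDegrees μ).support.card ≤ (Xs g).card :=
              Finset.card_le_card fun i hi => hrowsμ i (Finsupp.mem_support_iff.1 hi)
          _ ≤ k - 1 := by have := hXcard g; omega
      -- every monomial of `eval g` is row-multilinear of degree `d - deg μ ≥ k`
      have hmdeg : ∀ m ∈ (C.eval g).support, m.degree + μ.degree = d := by
        intro m hm
        rw [← map_add]
        exact hdegf _ (hμ m hm)
      have hmrow : ∀ m ∈ (C.eval g).support, ∀ i, rowDegrees m i ≤ 1 := by
        intro m hm i
        have h1 := hrow (m + μ) (hμ m hm) i
        rw [rowDegrees_add, Finsupp.add_apply] at h1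
        omega
      have hescape : ∀ m ∈ (C.eval g).support, ∀ Y : Finset (Fin n), Y.card < k →
          ∃ i ∉ Y, rowDegrees m i ≠ 0 := by
        intro m hm Y hY
        have hcard : Y.card < (rowDegrees m).support.card := by
          rw [← gamma_degree_eq_card_rows (hmrow m hm)]; have := hmdeg m hm; omega
        obtain ⟨i, hi, hiY⟩ := Finset.exists_mem_notMem_of_card_lt_card hcard
        exact ⟨i, hiY, Finsupp.mem_support_iff.1 hi⟩
      -- case analysis on the label of `g`
      rcases hl : C.label g with x | c | _ | _
      · -- an input variable: degree `1 < k`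
        have hev := C.eval_of_label_var hl
        have hm₁' := hm₁
        rw [hev, support_X, Finset.mem_singleton] at hm₁'
        have h1 := hmdeg m₁ hm₁
        rw [hm₁', Finsupp.degree_single] at h1
        omega
      · -- a constant: no rows at all
        have hev := C.eval_of_label_const hl
        have hm₁' := hm₁
        rw [hev, mem_support_iff, coeff_C] at hm₁'
        have hm0 : m₁ = 0 := by
          by_contra hne
          rw [if_neg (Ne.symm hne)] at hm₁'
          exact hm₁' rfl
        rw [hm0, rowDegrees_zero, Finsupp.zero_apply] at hmi₁
        exact hmi₁ rfl
      · -- a `+` gate: the child carrying `m₁` is used and big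
        have hev := C.eval_of_label_add hl
        have hm₁' := hm₁
        rw [hev] at hm₁'
        obtain ⟨h, hh, hmh⟩ := Finset.mem_biUnion.1 (support_sum hm₁')
        refine ih h hh ⟨μ, fun m hm => hμ m ?_⟩ ?_
        · rw [mem_support_iff] at hm ⊢
          rw [hev]
          intro h0
          have hle := coeff_le_coeff_sum (C.children g) (fun x => C.eval x) hh m
          rw [h0, nonpos_iff_eq_zero] at hle
          exact hm hle
        · obtain ⟨i, hiY, hi⟩ := hescape m₁ hm₁ (Xs h) (hXcard h)
          exact ⟨m₁, hmh, i, hiY, hi⟩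
      · -- a `×` gate
        have hev := C.eval_of_label_mul hl
        have hg0 : C.eval g ≠ 0 := fun h0 => by
          rw [h0, support_zero] at hm₁
          exact Finset.notMem_empty _ hm₁
        -- the children are used (G3) and nonzero
        have hG3 := (stub_mulGate_children_extend C f hl hg0 ⟨μ, hμ⟩).1
        have hch0 : ∀ h ∈ C.children g, C.eval h ≠ 0 := fun h hh h0 =>
          hg0 (by rw [hev]; exact Finset.prod_eq_zero hh h0)
        -- decompose `m₁` along the children and find the child carrying the row `i₁`
        have hm₁' := hm₁
        rw [hev] at hm₁'
        obtain ⟨ν, hν, hm₁eq⟩ := gamma_mem_support_prod (C.children g) (fun x => C.eval x) hm₁'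
        have hsumrow : rowDegrees m₁ i₁ = ∑ h ∈ C.children g, rowDegrees (ν h) i₁ := by
          rw [hm₁eq, rowDegrees, Finsupp.mapDomain_finsetSum, Finsupp.finsetSum_apply]
          rfl
        obtain ⟨h₁, hh₁, hνi₁⟩ : ∃ h₁ ∈ C.children g, rowDegrees (ν h₁) i₁ ≠ 0 := by
          by_contra hcon
          push Not at hcon
          exact hmi₁ (by rw [hsumrow]; exact Finset.sum_eq_zero hcon)
        have hν0 : ν h₁ ≠ 0 := by
          intro h0
          rw [h0, rowDegrees_zero, Finsupp.zero_apply] at hνi₁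
          exact hνi₁ rfl
        -- the non-constant children and their values
        set NC := (C.children g).filter (fun h => ∃ m ∈ (C.eval h).support, m ≠ 0) with hNC
        have hNCcard : NC.card ≤ d := by
          have hex : ∀ h : G, ∃ m : Fin n × Fin n →₀ ℕ,
              (h ∈ C.children g → m ∈ (C.eval h).support) ∧ (h ∈ NC → m ≠ 0) := by
            intro h
            by_cases hhN : h ∈ NC
            · obtain ⟨m, hm, hm0⟩ := (Finset.mem_filter.1 hhN).2
              exact ⟨m, fun _ => hm, fun _ => hm0⟩
            · by_cases hh : h ∈ C.children g
              · obtain ⟨m, hm⟩ := support_nonempty.2 (hch0 h hh)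
                exact ⟨m, fun _ => hm, fun h' => absurd h' hhN⟩
              · exact ⟨0, fun h' => absurd h' hh, fun h' => absurd h' hhN⟩
          choose ν' hν's hν'0 using hex
          have hM : ∑ h ∈ C.children g, ν' h ∈ (C.eval g).support := by
            rw [hev]
            exact gamma_sum_mem_support_prod (C.children g) (fun x => C.eval x)
              (fun h hh => hν's h hh)
          have hMd : (∑ h ∈ C.children g, ν' h).degree ≤ d := by have := hmdeg _ hM; omega
          rw [map_sum] at hMd
          calc NC.card = ∑ h ∈ NC, 1 := by rw [Finset.card_eq_sum_ones]
            _ ≤ ∑ h ∈ NC, (ν' h).degree := Finset.sum_le_sum fun h hh => by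
                rw [Nat.one_le_iff_ne_zero, Ne, Finsupp.degree_eq_zero_iff]
                exact hν'0 h hh
            _ ≤ ∑ h ∈ C.children g, (ν' h).degree :=
                Finset.sum_le_sum_of_subset (Finset.filter_subset _ _)
            _ ≤ d := hMd
        set T := NC.image C.eval with hT
        have hTcard : T.card + (Xs g).card < n := by
          have h1 : T.card ≤ NC.card := Finset.card_image_le
          have := hXcard g; omega
        have h8 : (Xs g).card + 9 ≤ n := by have := hXcard g; omega
        -- the orbit of `eval h₁` under `Alt([n] ∖ X_g)` stays in `T` (automorphisms fixing `g`)
        have horb : ∀ ρ : Equiv.Perm (Fin n), (∀ x ∈ Xs g, ρ x = x) → Equiv.Perm.sign ρ = 1 →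
            MvPolynomial.rename (fun p : Fin n × Fin n => (ρ p.1, ρ p.2)) (C.eval h₁) ∈ T := by
          intro ρ hρ hs
          obtain ⟨π, hπ, hπg⟩ := hXfix g ρ hρ hs
          have hπh : π h₁ ∈ C.children g := by
            have hc := hπ.children_apply g
            rw [hπg] at hc
            rw [hc, Finset.mem_map]
            exact ⟨h₁, hh₁, rfl⟩
          have hev₁ : C.eval (π h₁) =
              MvPolynomial.rename (fun p : Fin n × Fin n => (ρ p.1, ρ p.2)) (C.eval h₁) :=
            hπ.eval_apply h₁
          rw [hT, Finset.mem_image]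
          refine ⟨π h₁, Finset.mem_filter.2 ⟨hπh, ?_⟩, hev₁⟩
          refine ⟨Finsupp.mapDomain (fun p : Fin n × Fin n => (ρ p.1, ρ p.2)) (ν h₁), ?_, ?_⟩
          · rw [hev₁, mem_support_iff, coeff_rename_mapDomain _ (gamma_diag_injective ρ)]
            exact mem_support_iff.1 (hν h₁ hh₁)
          · intro h0
            apply hν0
            apply Finsupp.mapDomain_injective (gamma_diag_injective ρ)
            rw [h0, Finsupp.mapDomain_zero]
        -- G2: `eval h₁` is invariant under `Alt([n] ∖ X_g)`
        have hinv₁ := stub_altFixing_orbit_dichotomy (C.eval h₁) (Xs g) h8 T hTcard horb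
        -- hence it touches every row outside `X_g`
        have htouch : ∀ i ∉ Xs g, ∃ m ∈ (C.eval h₁).support, rowDegrees m i ≠ 0 := by
          intro i hi
          obtain ⟨ρ, hρX, hρs, hρa⟩ := gamma_exists_threeCycle hΩ3 hi₁ hi
          refine ⟨Finsupp.mapDomain (fun p : Fin n × Fin n => (ρ p.1, ρ p.2)) (ν h₁),
            hren _ ρ _ (hinv₁ ρ hρX hρs) (hν h₁ hh₁), ?_⟩
          rw [← hρa, hrenrow]
          exact hνi₁
        -- a row outside both supports
        obtain ⟨i, hi⟩ : ∃ i, i ∉ Xs g ∪ Xs h₁ := by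
          by_contra hcon
          push Not at hcon
          have h1 : Finset.univ ⊆ Xs g ∪ Xs h₁ := fun x _ => hcon x
          have h2 := Finset.card_le_card h1
          rw [Finset.card_univ, Fintype.card_fin] at h2
          have h3 := Finset.card_union_le (Xs g) (Xs h₁)
          have := hXcard g; have := hXcard h₁; omega
        rw [Finset.mem_union, not_or] at hi
        obtain ⟨m, hm, hmi⟩ := htouch i hi.1
        exact ih h₁ hh₁ (hG3 h₁ hh₁) ⟨m, hm, i, hi.2, hmi⟩
  -- the output gate is used (context `0`) and big (its monomials have `d ≥ k > |X|` rows)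
  obtain ⟨m, hm⟩ := support_nonempty.2 h0
  have hcard : (Xs (C.output ())).card < (rowDegrees m).support.card := by
    rw [← gamma_degree_eq_card_rows (hrow m hm), hdegf m hm]; have := hXcard (C.output ()); omega
  obtain ⟨i, hi, hiY⟩ := Finset.exists_mem_notMem_of_card_lt_card hcard
  exact key (C.output ()) ⟨0, fun m hm => by rwa [add_zero]⟩
    ⟨m, hm, i, hiY, Finsupp.mem_support_iff.1 hi⟩

end Summit.ValiantsHypothesis.ValiantsHypothesis.Theorems

end
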